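import Mathlib
import Summits.ValiantsHypothesis.ValiantsHypothesis.Theses.BarrierLever
import Summits.ValiantsHypothesis.ValiantsHypothesis.Theorems.BarrierLeverTransversalMinorLayoutsParabolicGlue

/-!
# Route BarrierLever — item stmt-ValiantsHypothesis-19690 `ParabolicCertificatesDecideTransversal`:
# generalized parabolic certificates (GP, item 19689) ⇒ TT (item 19152)

Seat val-np-p1 (cell valiant-natproofs, rung V4, 𝒟-side of door (c)).  The S-glue filed by planner
p1-g11: if for every pair of injective layouts `U, W : Fin r → Finset (Fin h)` (both read through
`ρ : b ↦ castAdd b` if `b ∈ member` else `natAdd b`) some literal relabelings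
`σ, π : Perm (Fin (h+h))` and some PARABOLIC matrix `g` (second-half rows vanish on first-half
columns) make the pairing matrix `[det g[σ ρ_{U i}, π ρ_{W j}]]_{i,j}` nonsingular
(`ParabolicCertificatesExist`, item 19689, hypothesis `GP` below VERBATIM), then every transversal
minor layout matrix is nonsingular for some `H` (`TransversalMinorLayoutsNonsingular`, item 19152).

Proof (pure un-relabeling, as in val-np-p2's
`Compression.transversalMinorLayoutsNonsingular_of_nestedRelabelings_of_parabolic`, p452737):
the column transversal of TT is `τ_w = ρ_{wᶜ}` entrywise, complementation keeps `w` injective, so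
GP applies to `(u, j ↦ (w j)ᶜ)`; the relabelings are removed by
`Compression.pairing_good_unrelabel_rows / _cols` (replace `g` by `g.submatrix σ π`), and the
parabolic side condition is simply dropped.

* `parabolicCertificatesDecideTransversal` — GP (19689's signature verbatim) → TT (the route decl).

The route-typed form `… : Theses.BarrierLever.ParabolicCertificatesDecideTransversal` is a one-line
corollary once the gate renders items 19689/19690 into the route file (link file to follow).

Definition-free.  WHAT THIS IS NOT: GP is an OPEN conjecture (censuses only: val-np-p2 g3,
kit j255171 / j255303 / j255494); nothing is proved here about GP or TT unconditionally, about
crux stmt-ValiantsHypothesis-14610, or about `VP` versus `VNP`.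
-/

-- layout Summits/ValiantsHypothesis/ValiantsHypothesis forces the duplicated namespace component
set_option linter.dupNamespace false

namespace Summit.ValiantsHypothesis.ValiantsHypothesis.Theorems.BarrierLever.ParabolicCert

open Summit.ValiantsHypothesis.ValiantsHypothesis.Theorems.BarrierLever.Compression

/-- **GP ⇒ TT** (item stmt-ValiantsHypothesis-19690): generalized parabolic certificates for all
injective layout pairs (hypothesis `GP` = item 19689 `ParabolicCertificatesExist` verbatim) imply
`TransversalMinorLayoutsNonsingular` (item 19152).  Un-relabel both sides; `τ_w = ρ_{wᶜ}`. -/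
theorem parabolicCertificatesDecideTransversal
    (GP : ∀ (h r : ℕ) (U W : Fin r → Finset (Fin h)), Function.Injective U →
      Function.Injective W → ∃ (σ π : Equiv.Perm (Fin (h + h)))
        (g : Matrix (Fin (h + h)) (Fin (h + h)) ℂ),
        (∀ a c : Fin h, g (Fin.natAdd h a) (Fin.castAdd h c) = 0) ∧
        (Matrix.of fun i j : Fin r => (g.submatrix
          (fun b : Fin h => σ (if b ∈ U i then Fin.castAdd h b else Fin.natAdd h b))
          (fun b : Fin h => π (if b ∈ W j then Fin.castAdd h b else Fin.natAdd h b))).det).det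
          ≠ 0) :
    Theses.BarrierLever.TransversalMinorLayoutsNonsingular := by
  classical
  intro h r u w hu hw
  -- the column transversal τ_w is ρ_{wᶜ}
  have hcol : ∀ j, (fun c : Fin h => if c ∈ w j then Fin.natAdd h c else Fin.castAdd h c) =
      (fun c : Fin h => if c ∈ (w j)ᶜ then Fin.castAdd h c else Fin.natAdd h c) := by
    intro j; funext c
    by_cases hc : c ∈ w j
    · rw [if_pos hc, if_neg (by simpa using hc)]
    · rw [if_neg hc, if_pos (Finset.mem_compl.mpr hc)]
  have hwc : Function.Injective (fun j => (w j)ᶜ) := by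
    intro j j' hjj'
    exact hw (compl_injective hjj')
  simp only [hcol]
  obtain ⟨σ, π, g, _, hg⟩ := GP h r u (fun j => (w j)ᶜ) hu hwc
  refine pairing_good_unrelabel_rows
    (fun (i : Fin r) (b : Fin h) => if b ∈ u i then Fin.castAdd h b else Fin.natAdd h b)
    (fun (j : Fin r) (c : Fin h) => if c ∈ (w j)ᶜ then Fin.castAdd h c else Fin.natAdd h c) σ ?_
  exact pairing_good_unrelabel_cols _ _ π ⟨g, hg⟩

end Summit.ValiantsHypothesis.ValiantsHypothesis.Theorems.BarrierLever.ParabolicCert
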